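import Summits.NavierStokesRegularity.NavierStokesRegularity.Theorems.StrainDoorsLocalNewtonB3
import Literature.Analysis.FluidPDE.NormalisedPressureAffine
import Literature.Analysis.FluidPDE.HarmonicProbe
import Literature.Analysis.FluidPDE.KNSSLocalSmoothingHolds
import Literature.Analysis.FluidPDE.PoincareBall
import HarnessLib

/-!
# StrainDoorsSmoothingScaling — engine plate «B3Scaling»: the far-field smoothing budget B3 with the SCALE made explicit

ROUND-47 (nsreg-p1 g34, `ROUND-47.md` §(1)(D), HANDOFF «R48 candidate (α) FLOATING WINDOW») asks for the ONE constant a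
scale-adapted parity door needs: atom B3 `HessSmoothingEnergyBound` (`Theorems/StrainDoorsLocalNewtonB3`, ns-s29-p2 g5) gives,
for FIXED `0 < r₀ < r₁`, a constant `C(r₀,r₁)` with `|∫ λ_ee(z)·ϖ(v)(x − z) dz| ≤ C·(‖v‖₂² + ‖∇v‖₂²)`, non-explicit in the
scales (a compactness bound on `D²λ`). This file makes the dependence on the scale exact by the Navier–Stokes scaling:
* `radialCutoff_dilate`, `newtonFar_dilate`, `newtonFarLaplacian_dilate`, ★ `smoothingHessKernel_dilate`:
  `λ_ee^{(γr₀,γr₁)}(z) = γ⁻⁵·λ_ee^{(r₀,r₁)}(γ⁻¹z)` (`γ > 0`; homogeneity of `Γ`, scale covariance of the radial cutoff,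
  tree `laplacian_const_smul_comp_smul` / `fderiv2_const_smul_comp_smul`);
* `integral_sq_norm_comp_affine`, `gradNormSq_comp_affine`, `sobolevFinite_comp_affine`: the energy, the enstrophy and the
  `H^∞` class under `v ↦ v(x + γ·)` (`γ⁻³`, `γ⁻¹`, closure);
* ★★ `hessSmoothing_dilate_le` («B3Scaling»): for `0 < r₀ < r₁` ONE `C ≥ 0` with, for EVERY `γ > 0`, every `H^∞` field `v`,
  every `x` and unit `e`,
  `|∫ λ_ee^{(γr₀,γr₁)}(z)·ϖ(v)(x − z) dz| ≤ C·(γ⁻⁵·∫‖v‖² + γ⁻³·‖∇v‖₂²)`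
  (B3 at `(r₀,r₁)` applied to `V = v(x + γ·)` at the point `0`, tree `normalisedPressure_comp_affine` (Ożański 2017 §2: the
  Riesz transforms commute with dilations and translations) and `Measure.integral_comp_smul`).
READING (for the planner; numbers, not adjectives): a window floating with a Type-I core radius `r(t) = c·√(ν(T − t))` has
D5-budget density `C·(E·r(t)⁻⁵ + ‖∇u(t)‖₂²·r(t)⁻³) ~ (T − t)^{-5/2}`, not integrable on `[t₀,T)`: the energy-class far-field
bound misses a scale-critical floating door by the exponent `3/2` — the typed location of the supercritical gap named in
ROUND-47 §(1). Everything here is PROVED (no named facts as hypotheses); `--supports stmt-NavierStokesRegularity-0056 --as helper`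
(LEAD S-door ns-s30-p1 g4, own engine plate, PLATE MAP R47 → R48).
HONEST FRAME: scaling bookkeeping of a true harmonic-analysis bound; items 0056 `NoTypeII`, 10661 and NS regularity are NOT
proved; no blow-up is excluded; nothing here is a route or a summit statement.
-/

noncomputable section

open MeasureTheory Set Function Filter Metric Real InnerProductSpace
open _root_.Topology
open scoped RealInnerProductSpace ContDiff ENNReal NNReal Laplacian
open Literature.Analysis Literature.Analysis.FluidPDE

set_option linter.dupNamespace false

namespace Summit.NavierStokesRegularity.NavierStokesRegularity.Theorems.StrainDoors

/-! ## §1 Dilation covariance of the cut kernels -/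

/-- the radial cutoff is scale covariant: `θ_{γr₀,γr₁}(z) = θ_{r₀,r₁}(γ⁻¹z)` (`γ ≠ 0`). -/
theorem radialCutoff_dilate {γ : ℝ} (hγ : γ ≠ 0) (r₀ r₁ : ℝ) (z : EuclideanSpace ℝ (Fin 3)) :
    FluidPDE.radialCutoff (γ * r₀) (γ * r₁) z = FluidPDE.radialCutoff r₀ r₁ (γ⁻¹ • z) := by
  unfold FluidPDE.radialCutoff FluidPDE.cutoffProfile
  have hγ2 : γ ^ 2 ≠ 0 := pow_ne_zero 2 hγ
  have hn : ‖γ⁻¹ • z‖ ^ 2 = γ⁻¹ ^ 2 * ‖z‖ ^ 2 := by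
    rw [norm_smul, mul_pow, Real.norm_eq_abs, sq_abs]
  rw [hn]
  congr 1
  rw [show (γ * r₁) ^ 2 - ‖z‖ ^ 2 = γ ^ 2 * (r₁ ^ 2 - γ⁻¹ ^ 2 * ‖z‖ ^ 2) by field_simp,
    show (γ * r₁) ^ 2 - (γ * r₀) ^ 2 = γ ^ 2 * (r₁ ^ 2 - r₀ ^ 2) by ring,
    mul_div_mul_left _ _ hγ2]

/-- the far kernel is homogeneous: `Γ∞_{γr₀,γr₁}(z) = γ⁻¹·Γ∞_{r₀,r₁}(γ⁻¹z)` (`γ > 0`). -/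
theorem newtonFar_dilate {γ : ℝ} (hγ : 0 < γ) (r₀ r₁ : ℝ) (z : EuclideanSpace ℝ (Fin 3)) :
    newtonFar (γ * r₀) (γ * r₁) z = γ⁻¹ • newtonFar r₀ r₁ (γ⁻¹ • z) := by
  unfold newtonFar
  have hK : newtonKernel z = γ⁻¹ * newtonKernel (γ⁻¹ • z) := by
    conv_lhs => rw [show z = γ • (γ⁻¹ • z) by rw [smul_inv_smul₀ hγ.ne']]
    exact newtonKernel_smul hγ _
  rw [radialCutoff_dilate hγ.ne', hK, smul_eq_mul]
  ring

/-- function form of `newtonFar_dilate`. -/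
theorem newtonFar_dilate' {γ : ℝ} (hγ : 0 < γ) (r₀ r₁ : ℝ) :
    newtonFar (γ * r₀) (γ * r₁) = fun z : EuclideanSpace ℝ (Fin 3) => γ⁻¹ • newtonFar r₀ r₁ (γ⁻¹ • z) :=
  funext fun z => newtonFar_dilate hγ r₀ r₁ z

/-- `λ_{γr₀,γr₁}(z) = γ⁻³·λ_{r₀,r₁}(γ⁻¹z)` (`γ > 0`; `Δ(a·f(b·)) = ab²·(Δf)(b·)`). -/
theorem newtonFarLaplacian_dilate {γ : ℝ} (hγ : 0 < γ) (r₀ r₁ : ℝ) (z : EuclideanSpace ℝ (Fin 3)) :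
    newtonFarLaplacian (γ * r₀) (γ * r₁) z = γ⁻¹ ^ 3 * newtonFarLaplacian r₀ r₁ (γ⁻¹ • z) := by
  unfold newtonFarLaplacian
  rw [newtonFar_dilate' hγ, laplacian_const_smul_comp_smul _ _ (inv_ne_zero hγ.ne'), smul_eq_mul]
  ring

/-- function form of `newtonFarLaplacian_dilate`. -/
theorem newtonFarLaplacian_dilate' {γ : ℝ} (hγ : 0 < γ) (r₀ r₁ : ℝ) :
    newtonFarLaplacian (γ * r₀) (γ * r₁) =
      fun z : EuclideanSpace ℝ (Fin 3) => (γ⁻¹ ^ 3) • newtonFarLaplacian r₀ r₁ (γ⁻¹ • z) :=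
  funext fun z => by rw [newtonFarLaplacian_dilate hγ, smul_eq_mul]

/-- ★ the Hessian smoothing kernel is homogeneous of degree `−5` in the scale:
`λ_ee^{(γr₀,γr₁)}(z) = γ⁻⁵·λ_ee^{(r₀,r₁)}(γ⁻¹z)` (`γ > 0`, `0 < r₀ < r₁`). -/
theorem smoothingHessKernel_dilate {γ r₀ r₁ : ℝ} (hγ : 0 < γ) (hr₀ : 0 < r₀) (hr₁ : r₀ < r₁)
    (e z : EuclideanSpace ℝ (Fin 3)) :
    smoothingHessKernel (γ * r₀) (γ * r₁) e z = γ⁻¹ ^ 5 * smoothingHessKernel r₀ r₁ e (γ⁻¹ • z) := by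
  have hγr₀ : 0 < γ * r₀ := mul_pos hγ hr₀
  have hγr₁ : γ * r₀ < γ * r₁ := mul_lt_mul_of_pos_left hr₁ hγ
  rw [smoothingHessKernel_eq hγr₀ hγr₁, smoothingHessKernel_eq hr₀ hr₁, newtonFarLaplacian_dilate' hγ,
    fderiv2_const_smul_comp_smul _ _ (inv_ne_zero hγ.ne')]
  simp only [FunLike.coe_smul, Pi.smul_apply, smul_eq_mul]
  ring

/-! ## §2 Energy, enstrophy and the `H^∞` class under `v ↦ v(x + γ·)` -/

/-- `frobeniusNormSq (k • M) = k²·frobeniusNormSq M`. -/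
theorem frobeniusNormSq_const_smul (k : ℝ)
    (M : EuclideanSpace ℝ (Fin 3) →L[ℝ] EuclideanSpace ℝ (Fin 3)) :
    frobeniusNormSq (k • M) = k ^ 2 * frobeniusNormSq M := by
  unfold frobeniusNormSq
  simp only [FunLike.coe_smul, Pi.smul_apply, norm_smul, Real.norm_eq_abs, mul_pow, sq_abs, Finset.mul_sum]

/-- `finrank ℝ ℝ³ = 3` in the form the change-of-variables lemmas produce. -/
theorem abs_inv_pow_finrank {γ : ℝ} (hγ : 0 < γ) :
    |(γ ^ Module.finrank ℝ (EuclideanSpace ℝ (Fin 3)))⁻¹| = γ⁻¹ ^ 3 := by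
  rw [finrank_euclideanSpace, Fintype.card_fin, abs_of_nonneg (inv_nonneg.2 (pow_nonneg hγ.le 3)), inv_pow]

/-- energy under the affine substitution: `∫‖v(x + γy)‖² dy = γ⁻³·∫‖v‖²` (`γ > 0`; Bochner, junk-compatible). -/
theorem integral_sq_norm_comp_affine (v : EuclideanSpace ℝ (Fin 3) → EuclideanSpace ℝ (Fin 3)) (x : EuclideanSpace ℝ (Fin 3))
    {γ : ℝ} (hγ : 0 < γ) :
    ∫ y, ‖v (x + γ • y)‖ ^ 2 = γ⁻¹ ^ 3 * ∫ y, ‖v y‖ ^ 2 := by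
  have h : ∫ y, ‖v (x + γ • y)‖ ^ 2 =
      |(γ ^ Module.finrank ℝ (EuclideanSpace ℝ (Fin 3)))⁻¹| • ∫ w, ‖v (x + w)‖ ^ 2 :=
    Measure.integral_comp_smul volume (fun w => ‖v (x + w)‖ ^ 2) γ
  rw [h, abs_inv_pow_finrank hγ, smul_eq_mul, integral_add_left_eq_self (fun w => ‖v w‖ ^ 2) x]

/-- the differential under the affine substitution: `D[v(x + γ·)](y) = γ·Dv(x + γy)`. -/
theorem fderiv_comp_affine (v : EuclideanSpace ℝ (Fin 3) → EuclideanSpace ℝ (Fin 3)) (x : EuclideanSpace ℝ (Fin 3))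
    (γ : ℝ) (y : EuclideanSpace ℝ (Fin 3)) :
    fderiv ℝ (fun y => v (x + γ • y)) y = γ • fderiv ℝ v (x + γ • y) := by
  have h := _root_.fderiv_comp_smul (f := fun w => v (x + w)) (x := y) γ
  simp only [fderiv_comp_add_left] at h
  exact h

/-- enstrophy under the affine substitution: `‖∇[v(x + γ·)]‖₂² = γ⁻¹·‖∇v‖₂²` (`γ > 0`). -/
theorem gradNormSq_comp_affine (v : EuclideanSpace ℝ (Fin 3) → EuclideanSpace ℝ (Fin 3)) (x : EuclideanSpace ℝ (Fin 3))
    {γ : ℝ} (hγ : 0 < γ) :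
    VectorCalculus.gradNormSq (fun y => v (x + γ • y)) = γ⁻¹ * VectorCalculus.gradNormSq v := by
  unfold VectorCalculus.gradNormSq
  simp_rw [fderiv_comp_affine, frobeniusNormSq_const_smul, integral_const_mul]
  have h : ∫ y, frobeniusNormSq (fderiv ℝ v (x + γ • y)) =
      |(γ ^ Module.finrank ℝ (EuclideanSpace ℝ (Fin 3)))⁻¹| • ∫ w, frobeniusNormSq (fderiv ℝ v (x + w)) :=
    Measure.integral_comp_smul volume (fun w => frobeniusNormSq (fderiv ℝ v (x + w))) γ
  rw [h, abs_inv_pow_finrank hγ, smul_eq_mul,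
    integral_add_left_eq_self (fun w => frobeniusNormSq (fderiv ℝ v w)) x]
  have hγ0 : γ ≠ 0 := hγ.ne'
  field_simp

/-- the `H^∞` class is closed under the affine substitution (`‖Dⁿ[v(x + γ·)](y)‖ ≤ γⁿ‖Dⁿv(x + γy)‖` and
`∫⁻ G(γy + x) dy = γ⁻³∫⁻ G`). -/
theorem sobolevFinite_comp_affine {v : EuclideanSpace ℝ (Fin 3) → EuclideanSpace ℝ (Fin 3)}
    (hH : ∀ n : ℕ, ∫⁻ y, ‖iteratedFDeriv ℝ n v y‖ₑ ^ 2 < ⊤) (x : EuclideanSpace ℝ (Fin 3)) {γ : ℝ} (hγ : 0 < γ)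
    (n : ℕ) : ∫⁻ y, ‖iteratedFDeriv ℝ n (fun y => v (x + γ • y)) y‖ₑ ^ 2 < ⊤ := by
  have hpt : ∀ y, ‖iteratedFDeriv ℝ n (fun y => v (x + γ • y)) y‖ₑ ^ 2 ≤
      ENNReal.ofReal ((|γ| ^ n) ^ 2) * ‖iteratedFDeriv ℝ n v (γ • y + x)‖ₑ ^ 2 := by
    intro y
    have h1 : (fun y => v (x + γ • y)) = fun y => (fun w => v (x + w)) (γ • y) := rfl
    have hle := norm_iteratedFDeriv_comp_smul_le (fun w => v (x + w)) hγ.ne' n y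
    rw [iteratedFDeriv_comp_add_left] at hle
    rw [h1, add_comm (γ • y) x, ← ofReal_norm, ← ofReal_norm, ← ENNReal.ofReal_pow (norm_nonneg _),
      ← ENNReal.ofReal_pow (norm_nonneg _), ← ENNReal.ofReal_mul (sq_nonneg _), ← mul_pow]
    exact ENNReal.ofReal_le_ofReal (pow_le_pow_left₀ (norm_nonneg _) hle 2)
  refine lt_of_le_of_lt (lintegral_mono hpt) ?_
  rw [lintegral_const_mul' _ _ ENNReal.ofReal_ne_top,
    PoincareBall.lintegral_comp_smul_add (fun w => ‖iteratedFDeriv ℝ n v w‖ₑ ^ 2) hγ.ne' x]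
  exact ENNReal.mul_lt_top ENNReal.ofReal_lt_top (ENNReal.mul_lt_top ENNReal.ofReal_lt_top (hH n))

/-- the `C^∞` class is closed under the affine substitution. -/
theorem contDiff_comp_affine {v : EuclideanSpace ℝ (Fin 3) → EuclideanSpace ℝ (Fin 3)} (hv : ContDiff ℝ ∞ v)
    (x : EuclideanSpace ℝ (Fin 3)) (γ : ℝ) : ContDiff ℝ ∞ (fun y => v (x + γ • y)) :=
  hv.comp (contDiff_const.add (contDiff_const_smul γ))

/-! ## §3 ★★ B3 with the scale explicit -/

/-- the smoothing pairing at scale `γ` is `γ⁻²` times the pairing at scale `1` against the rescaled field: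
`∫ λ_ee^{(γr₀,γr₁)}(z)·ϖ(v)(x − z) dz = γ⁻²·∫ λ_ee^{(r₀,r₁)}(w)·ϖ(v(x + γ·))(0 − w) dw`. -/
theorem integral_smoothingHessKernel_dilate {γ r₀ r₁ : ℝ} (hγ : 0 < γ) (hr₀ : 0 < r₀) (hr₁ : r₀ < r₁)
    (v : EuclideanSpace ℝ (Fin 3) → EuclideanSpace ℝ (Fin 3)) (x e : EuclideanSpace ℝ (Fin 3)) :
    ∫ z, smoothingHessKernel (γ * r₀) (γ * r₁) e z * normalisedPressure v (x - z) =
      γ⁻¹ ^ 2 * ∫ w, smoothingHessKernel r₀ r₁ e w * normalisedPressure (fun y => v (x + γ • y)) (0 - w) := by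
  have hγ0 : γ ≠ 0 := hγ.ne'
  have h1 : (fun z => smoothingHessKernel (γ * r₀) (γ * r₁) e z * normalisedPressure v (x - z)) =
      fun z => γ⁻¹ ^ 5 * smoothingHessKernel r₀ r₁ e (γ⁻¹ • z) * normalisedPressure v (x - γ • (γ⁻¹ • z)) := by
    funext z
    rw [smoothingHessKernel_dilate hγ hr₀ hr₁, smul_inv_smul₀ hγ0]
  have h2 : ∀ w, normalisedPressure v (x - γ • w) = normalisedPressure (fun y => v (x + γ • y)) (0 - w) := by
    intro w
    rw [normalisedPressure_comp_affine v x hγ, zero_sub, smul_neg, sub_eq_add_neg]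
  have h3 : ∫ z, γ⁻¹ ^ 5 * smoothingHessKernel r₀ r₁ e (γ⁻¹ • z) * normalisedPressure v (x - γ • (γ⁻¹ • z)) =
      |(γ⁻¹ ^ Module.finrank ℝ (EuclideanSpace ℝ (Fin 3)))⁻¹| •
        ∫ w, γ⁻¹ ^ 5 * smoothingHessKernel r₀ r₁ e w * normalisedPressure v (x - γ • w) :=
    Measure.integral_comp_smul volume
      (fun w => γ⁻¹ ^ 5 * smoothingHessKernel r₀ r₁ e w * normalisedPressure v (x - γ • w)) γ⁻¹
  rw [h1, h3, finrank_euclideanSpace, Fintype.card_fin, inv_pow, inv_inv, abs_of_nonneg (pow_nonneg hγ.le 3),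
    smul_eq_mul]
  simp_rw [mul_assoc, integral_const_mul, h2]
  field_simp

/-- ★★ **engine plate «B3Scaling»**: for `0 < r₀ < r₁` ONE constant `C = C(r₀,r₁) ≥ 0` such that for EVERY scale factor
`γ > 0`, every `H^∞` field `v`, every `x` and unit `e`,
`|∫ λ_ee^{(γr₀,γr₁)}(z)·ϖ(v)(x − z) dz| ≤ C·(γ⁻⁵·∫‖v‖² + γ⁻³·‖∇v‖₂²)` — atom B3 with its dependence on the scale exact. -/
theorem hessSmoothing_dilate_le {r₀ r₁ : ℝ} (hr₀ : 0 < r₀) (hr₁ : r₀ < r₁) :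
    ∃ C : ℝ, 0 ≤ C ∧ ∀ (γ : ℝ), 0 < γ →
      ∀ (v : (EuclideanSpace ℝ (Fin 3)) → (EuclideanSpace ℝ (Fin 3))),
        ContDiff ℝ ∞ v → (∀ n : ℕ, ∫⁻ x, ‖iteratedFDeriv ℝ n v x‖ₑ ^ 2 < ⊤) →
        ∀ (x e : EuclideanSpace ℝ (Fin 3)), ‖e‖ = 1 →
          |∫ z, smoothingHessKernel (γ * r₀) (γ * r₁) e z * normalisedPressure v (x - z)| ≤
            C * (γ⁻¹ ^ 5 * (∫ y, ‖v y‖ ^ 2) + γ⁻¹ ^ 3 * VectorCalculus.gradNormSq v) := by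
  obtain ⟨C, hC0, hC⟩ := hessSmoothingEnergyBound_holds r₀ r₁ hr₀ hr₁
  refine ⟨C, hC0, fun γ hγ v hv hH x e he => ?_⟩
  have hB := hC (fun y => v (x + γ • y)) (contDiff_comp_affine hv x γ) (sobolevFinite_comp_affine hH x hγ) 0 e he
  rw [integral_sq_norm_comp_affine v x hγ, gradNormSq_comp_affine v x hγ] at hB
  rw [integral_smoothingHessKernel_dilate hγ hr₀ hr₁, abs_mul, abs_of_nonneg (pow_nonneg (inv_nonneg.2 hγ.le) 2)]
  calc γ⁻¹ ^ 2 * |∫ w, smoothingHessKernel r₀ r₁ e w * normalisedPressure (fun y => v (x + γ • y)) (0 - w)|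
      ≤ γ⁻¹ ^ 2 * (C * (γ⁻¹ ^ 3 * (∫ y, ‖v y‖ ^ 2) + γ⁻¹ * VectorCalculus.gradNormSq v)) :=
      mul_le_mul_of_nonneg_left hB (pow_nonneg (inv_nonneg.2 hγ.le) 2)
    _ = C * (γ⁻¹ ^ 5 * (∫ y, ‖v y‖ ^ 2) + γ⁻¹ ^ 3 * VectorCalculus.gradNormSq v) := by ring

/-- unit-base form: for a fixed shape ratio `κ > 1`, ONE `C(κ)` with
`|∫ λ_ee^{(r,κr)}(z)·ϖ(v)(x − z) dz| ≤ C·(r⁻⁵·∫‖v‖² + r⁻³·‖∇v‖₂²)` for every scale `r > 0`. -/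
theorem hessSmoothing_scale_le {κ : ℝ} (hκ : 1 < κ) :
    ∃ C : ℝ, 0 ≤ C ∧ ∀ (r : ℝ), 0 < r →
      ∀ (v : (EuclideanSpace ℝ (Fin 3)) → (EuclideanSpace ℝ (Fin 3))),
        ContDiff ℝ ∞ v → (∀ n : ℕ, ∫⁻ x, ‖iteratedFDeriv ℝ n v x‖ₑ ^ 2 < ⊤) →
        ∀ (x e : EuclideanSpace ℝ (Fin 3)), ‖e‖ = 1 →
          |∫ z, smoothingHessKernel r (κ * r) e z * normalisedPressure v (x - z)| ≤
            C * (r⁻¹ ^ 5 * (∫ y, ‖v y‖ ^ 2) + r⁻¹ ^ 3 * VectorCalculus.gradNormSq v) := by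
  obtain ⟨C, hC0, hC⟩ := hessSmoothing_dilate_le one_pos hκ
  refine ⟨C, hC0, fun r hr v hv hH x e he => ?_⟩
  have h := hC r hr v hv hH x e he
  rwa [mul_one, mul_comm r κ] at h

end Summit.NavierStokesRegularity.NavierStokesRegularity.Theorems.StrainDoors

end
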